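import Summits.CriticalPhenomena.PercolationContinuityZ3.Theorems.PercNearOneGluingNoHeavyLowerTailIncStarIrreducible
import Summits.CriticalPhenomena.PercolationContinuityZ3.Theorems.PercNearOneGluingNoHeavyLowerTailIncStarMarkPairSteps
import HarnessLib

/-!
# The increasing star reduces to irreducible marked graphs whose four marks form an INDEPENDENT SET

Support file for the Sahi programme (`--supports stmt-CriticalPhenomena-4575`, prover prim-sahi-p2 gen 13).  No definitions, no named
facts, no sorries; standard axioms.  Memo `…/prim-sahi-p2/PROOF-E3.md` §24, `FROM-prim-sahi-p2-gen13-INDEPENDENT-MARKS.md`.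

**Theorem `incStar_of_irreducible_indep`** sharpens gen 12's `IncStarIrreducible.incStar_of_irreducible`: the increasing-star inequality
`0 ≤ E₃({s↔a},{s↔b},{s↔c})` holds for every weight on every finite vertex type and all marks as soon as it holds for every weight
`w : Sym2 (Fin n) → [0,1]` and marks `s, a, b, c` forming an irreducible marked weighted graph (pairwise distinct marks, no loops, 2-connected,
no unmarked vertex of degree `≤ 2`, no blob, no targetless root side — the five clauses of gen 12) in which moreover
* (root–target) `w s(s,a) = w s(s,b) = w s(s,c) = 0`, and
* (target–target) `w s(a,b) = w s(a,c) = w s(b,c) = 0`,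
i.e. the four marked vertices form an independent set of the support graph.

**Proof.**  Inside the vertex induction of gen 12 run a second induction on the number of mark–mark pairs of positive weight.  Along such a
pair `e` the star is a Bernstein cubic in `p_e` (`EdgeInduction.sahiE3_oneBond`) whose end coefficients are the star under `w[e↦0]` (one positive
mark pair fewer: inner induction hypothesis) and under `w[e↦1]` (a target almost surely glued to the root, resp. two targets glued together:
`Cov ≥ 0` resp. `(1 − q)(2·q' − q·q'') ≥ 0` by Harris, `IncStarIrreducible.incStar_rootTarget_one` / `incStar_targetTarget_one`, …IncStarMarkPairSteps), and whose two mixed coefficients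
are nonnegative by the exact cone certificates `IncStar.rootTarget_polar_nonneg` (gen 4) and `IncStar.targetTarget_polar_nonneg` (gen 13), both of
which take the star under `w[e↦0]` as their only hypothesis.  When no mark pair is positive, gen 12's clause analysis applies verbatim.
Corollary `incStar_of_irreducible_indep_six`: such graphs have at least six vertices (structural, standard axioms — four independent marks on
five vertices make the unmarked vertex a cut vertex), superseding the computational `incStar_of_irreducible_six`.
What is NOT here: any claim that such graphs satisfy the star (the open increasing-star conjecture; certified for `n ≤ 7` by the K₇ fibre array).
-/

noncomputable section

namespace Summit.CriticalPhenomena.PercolationContinuityZ3.Theorems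

namespace IncStarIrreducible

open Finset MeasureTheory Literature.Combinatorics.Sahi2008 Literature.Probability.Percolation
  Literature.Probability.LatticeModels EdgeInduction
open Literature.Probability.Percolation.DecisionTree (ind ind_of_mem ind_of_not_mem ind_nonneg)
open Literature.Probability.Percolation.BlockExploration (exists_openWalk_of_mem_openConnIn
  mem_openConn_iff_openConnIn_univ)
open scoped Classical

variable {n : ℕ}

/-! ### The sharpened reduction theorem -/

/-- **The increasing star holds everywhere as soon as it holds on every irreducible marked weighted graph whose four marks form an
independent set.**  Hypothesis `H`: the star for every weight on `Fin n` and marks `s a b c` that are pairwise distinct, loop-free, 2-connected,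
with every unmarked vertex of degree `≥ 3`, no blob, no targetless root side (the clauses of `incStar_of_irreducible`), AND with
`w s(s,a) = w s(s,b) = w s(s,c) = 0` (no root–target pair) and `w s(a,b) = w s(a,c) = w s(b,c) = 0` (no target–target pair). [this work] -/
theorem incStar_of_irreducible_indep
    (H : ∀ (n : ℕ) (w : Sym2 (Fin n) → unitInterval) (s a b c : Fin n),
      s ≠ a → s ≠ b → s ≠ c → a ≠ b → a ≠ c → b ≠ c →
      (∀ x : Fin n, w s(x, x) = 0) →
      (∀ (V₁ V₂ : Finset (Fin n)) (x : Fin n), (∀ y, y ∈ V₁ → y ∈ V₂ → y = x) → x ∈ V₁ → x ∈ V₂ → s ∈ V₁ →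
          (∀ y, y ∈ V₁ ∨ y ∈ V₂) → (∀ y z, y ∈ V₁ → z ∈ V₂ → y ≠ x → z ≠ x → w s(y, z) = 0) →
          (∀ y ∈ V₁, y = x) ∨ (∀ z ∈ V₂, z = x)) →
      (∀ x y y' : Fin n, x ≠ s → x ≠ a → x ≠ b → x ≠ c → x ≠ y → x ≠ y' → y ≠ y' →
          ∃ z, z ≠ y ∧ z ≠ y' ∧ w s(x, z) ≠ 0) →
      (∀ (B : Finset (Fin n)) (u v : Fin n), B.Nonempty → u ∉ B → v ∉ B → u ≠ v → s ∉ B → a ∉ B → b ∉ B → c ∉ B →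
          ∃ x ∈ B, ∃ z, z ∉ B ∧ z ≠ u ∧ z ≠ v ∧ w s(x, z) ≠ 0) →
      (∀ (R : Finset (Fin n)) (h u v : Fin n), s ∈ R → h ∈ R → h ≠ s → u ∉ R → v ∉ R → u ≠ v → a ∉ R → b ∉ R →
          c ∉ R → ∃ x ∈ R, ∃ z, z ∉ R ∧ z ≠ u ∧ z ≠ v ∧ w s(x, z) ≠ 0) →
      w s(s, a) = 0 → w s(s, b) = 0 → w s(s, c) = 0 → w s(a, b) = 0 → w s(a, c) = 0 → w s(b, c) = 0 →
      0 ≤ sahiE3 (prodBernoulli w) (openConn s a) (openConn s b) (openConn s c))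
    {V : Type*} [Fintype V] (w : Sym2 V → unitInterval) (s a b c : V) :
    0 ≤ sahiE3 (prodBernoulli w) (openConn s a) (openConn s b) (openConn s c) := by
  -- the statement on `Fin n`, by strong induction on `n`
  have finv : ∀ (n : ℕ) (w : Sym2 (Fin n) → unitInterval) (s a b c : Fin n),
      0 ≤ sahiE3 (prodBernoulli w) (openConn s a) (openConn s b) (openConn s c) := by
    intro n
    induction n using Nat.strong_induction_on with
    | _ n ih =>
    -- inner induction on the number of mark–mark pairs of nonzero weight
    suffices inner : ∀ (k : ℕ) (w : Sym2 (Fin n) → unitInterval) (s a b c : Fin n),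
        (({s(s, a), s(s, b), s(s, c), s(a, b), s(a, c), s(b, c)} : Finset (Sym2 (Fin n))).filter fun e => w e ≠ 0).card = k →
        0 ≤ sahiE3 (prodBernoulli w) (openConn s a) (openConn s b) (openConn s c) from
      fun w s a b c => inner _ w s a b c rfl
    intro k
    induction k using Nat.strong_induction_on with
    | _ k ihk =>
    intro w₁ s a b c hk
    -- (0) coincident marks
    by_cases hdist : s ≠ a ∧ s ≠ b ∧ s ≠ c ∧ a ≠ b ∧ a ≠ c ∧ b ≠ c
    swap
    · push Not at hdist
      refine incStar_of_not_distinct w₁ ?_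
      tauto
    obtain ⟨hsa, hsb, hsc, hab, hac, hbc⟩ := hdist
    -- (00) a mark–mark pair of nonzero weight: Bernstein step along it
    set M : Finset (Sym2 (Fin n)) := {s(s, a), s(s, b), s(s, c), s(a, b), s(a, c), s(b, c)} with hMdef
    by_cases hpair : ∃ e ∈ M, w₁ e ≠ 0
    · obtain ⟨e, heM, hne⟩ := hpair
      -- the star under `w₁[e↦0]`, by the inner induction hypothesis
      have hlt : (M.filter fun f => Function.update w₁ e 0 f ≠ 0).card < (M.filter fun f => w₁ f ≠ 0).card := by
        have hsub : (M.filter fun f => Function.update w₁ e 0 f ≠ 0) ⊆ (M.filter fun f => w₁ f ≠ 0).erase e := by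
          intro f hf
          rw [Finset.mem_filter] at hf
          have hfe : f ≠ e := by
            rintro rfl; exact hf.2 (by rw [Function.update_self])
          rw [Function.update_of_ne hfe] at hf
          exact Finset.mem_erase.2 ⟨hfe, Finset.mem_filter.2 hf⟩
        have hmem : e ∈ M.filter fun f => w₁ f ≠ 0 := Finset.mem_filter.2 ⟨heM, hne⟩
        calc (M.filter fun f => Function.update w₁ e 0 f ≠ 0).card
            ≤ ((M.filter fun f => w₁ f ≠ 0).erase e).card := Finset.card_le_card hsub
          _ < (M.filter fun f => w₁ f ≠ 0).card := Finset.card_erase_lt_of_mem hmem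
      have IH0 : ∀ (t₁ t₂ t₃ : Fin n),
          (t₁ = a ∧ t₂ = b ∧ t₃ = c) ∨ (t₁ = b ∧ t₂ = a ∧ t₃ = c) ∨ (t₁ = c ∧ t₂ = a ∧ t₃ = b) →
          0 ≤ sahiE3 (prodBernoulli (Function.update w₁ e 0)) (openConn s t₁) (openConn s t₂) (openConn s t₃) := by
        have base := ihk _ (hk ▸ hlt) (Function.update w₁ e 0) s a b c rfl
        rintro t₁ t₂ t₃ (⟨rfl, rfl, rfl⟩ | ⟨rfl, rfl, rfl⟩ | ⟨rfl, rfl, rfl⟩)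
        · exact base
        · rwa [sahiE3_comm₁₂]
        · rwa [sahiE3_comm₁₂, sahiE3_comm₂₃]
      simp only [hMdef, Finset.mem_insert, Finset.mem_singleton] at heM
      rcases heM with rfl | rfl | rfl | rfl | rfl | rfl
      · exact incStar_step_rootTarget w₁ b c hsa (IH0 a b c (Or.inl ⟨rfl, rfl, rfl⟩))
      · rw [sahiE3_comm₁₂]
        exact incStar_step_rootTarget w₁ a c hsb (IH0 b a c (Or.inr (Or.inl ⟨rfl, rfl, rfl⟩)))
      · rw [sahiE3_comm₂₃, sahiE3_comm₁₂]
        exact incStar_step_rootTarget w₁ a b hsc (IH0 c a b (Or.inr (Or.inr ⟨rfl, rfl, rfl⟩)))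
      · exact incStar_step_targetTarget w₁ s a b c (IH0 a b c (Or.inl ⟨rfl, rfl, rfl⟩))
      · rw [sahiE3_comm₂₃]
        have h0 := IH0 a b c (Or.inl ⟨rfl, rfl, rfl⟩)
        rw [sahiE3_comm₂₃] at h0
        exact incStar_step_targetTarget w₁ s a c b h0
      · rw [sahiE3_comm₁₂, sahiE3_comm₂₃]
        have h0 := IH0 b a c (Or.inr (Or.inl ⟨rfl, rfl, rfl⟩))
        rw [sahiE3_comm₂₃] at h0
        exact incStar_step_targetTarget w₁ s b c a h0
    -- from here on every mark–mark pair has weight zero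
    push Not at hpair
    have hM0 : ∀ e ∈ M, w₁ e = 0 := hpair
    have zSA : w₁ s(s, a) = 0 := hM0 _ (by simp [hMdef])
    have zSB : w₁ s(s, b) = 0 := hM0 _ (by simp [hMdef])
    have zSC : w₁ s(s, c) = 0 := hM0 _ (by simp [hMdef])
    have zAB : w₁ s(a, b) = 0 := hM0 _ (by simp [hMdef])
    have zAC : w₁ s(a, c) = 0 := hM0 _ (by simp [hMdef])
    have zBC : w₁ s(b, c) = 0 := hM0 _ (by simp [hMdef])
    -- loops off
    obtain ⟨w, hwdef⟩ : ∃ w : Sym2 (Fin n) → unitInterval, ∀ e, w e = if e.IsDiag then 0 else w₁ e := ⟨_, fun e => rfl⟩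
    rw [sahiE3_openConn_congr_offDiag w₁ w (fun e he => by rw [hwdef, if_neg he]) s a b c]
    have hloop : ∀ x : Fin n, w s(x, x) = 0 := fun x => by rw [hwdef, if_pos (Sym2.mk_isDiag_iff.2 rfl)]
    have hwle : ∀ e, w₁ e = 0 → w e = 0 := fun e he => by
      rw [hwdef]; split_ifs
      · rfl
      · exact he
    have hcardn : Fintype.card (Fin n) = n := Fintype.card_fin n
    -- the induction hypothesis, transported into any proper vertex set
    have IH : ∀ (w' : Sym2 (Fin n) → unitInterval) (S : Finset (Fin n)), S.card < n → ∀ {x t₁ t₂ t₃ : Fin n},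
        x ∈ S → t₁ ∈ S → t₂ ∈ S → t₃ ∈ S →
        0 ≤ sahiE3 (prodBernoulli w') (openConnIn (↑S : Set (Fin n)) x t₁) (openConnIn (↑S : Set (Fin n)) x t₂)
          (openConnIn (↑S : Set (Fin n)) x t₃) :=
      fun w' S hS x t₁ t₂ t₃ hx h₁ h₂ h₃ => incStar_openConnIn_of_fin (ih S.card hS) w' S rfl hx h₁ h₂ h₃
    -- (1) a cut vertex
    by_cases hI1 : ∀ (V₁ V₂ : Finset (Fin n)) (x : Fin n), (∀ y, y ∈ V₁ → y ∈ V₂ → y = x) → x ∈ V₁ → x ∈ V₂ → s ∈ V₁ →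
        (∀ y, y ∈ V₁ ∨ y ∈ V₂) → (∀ y z, y ∈ V₁ → z ∈ V₂ → y ≠ x → z ≠ x → w s(y, z) = 0) →
        (∀ y ∈ V₁, y = x) ∨ (∀ z ∈ V₂, z = x)
    swap
    · push Not at hI1
      obtain ⟨V₁, V₂, x, hV, hx₁, hx₂, hs₁, hunion, hsep, ⟨y₀, hy₀, hy₀x⟩, ⟨z₀, hz₀, hz₀x⟩⟩ := hI1
      have hz₀V₁ : z₀ ∉ V₁ := fun h => hz₀x (hV z₀ h hz₀)
      have hy₀V₂ : y₀ ∉ V₂ := fun h => hy₀x (hV y₀ hy₀ h)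
      have hlt₁ : V₁.card < n := by simpa [hcardn] using Finset.card_lt_univ_of_notMem hz₀V₁
      have hlt₂ : V₂.card < n := by simpa [hcardn] using Finset.card_lt_univ_of_notMem hy₀V₂
      refine IncStarCutVertex.incStar_of_cutVertex w (V₁ := (↑V₁ : Set (Fin n))) (V₂ := (↑V₂ : Set (Fin n)))
        (a := x) (s := s) (fun y hy hy' => hV y hy hy') hx₁ hx₂ hs₁ (fun y => ?_) (fun y z hy hz hyx hzx => hsep y z hy hz hyx hzx)
        (fun p q r hp hq hr => IH w V₁ hlt₁ hs₁ hp hq hr) (fun p q r hp hq hr => IH w V₂ hlt₂ hx₂ hp hq hr) a b c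
      rcases hunion y with h | h
      · exact Or.inl h
      · exact Or.inr h
    -- (2) an unmarked vertex of degree ≤ 2 (series / pendant / isolated)
    by_cases hI2 : ∀ x y y' : Fin n, x ≠ s → x ≠ a → x ≠ b → x ≠ c → x ≠ y → x ≠ y' → y ≠ y' →
        ∃ z, z ≠ y ∧ z ≠ y' ∧ w s(x, z) ≠ 0
    swap
    · push Not at hI2
      obtain ⟨x, y, y', hxs, hxa, hxb, hxc, hxy, hxy', hyy', hdeg⟩ := hI2
      have hval : (1 : ℝ) - (1 - w s(y, y')) * (1 - w s(x, y) * w s(x, y')) ∈ unitInterval := by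
        have p0 := (w s(y, y')).2.1; have p1 := (w s(y, y')).2.2
        have q0 := (w s(x, y)).2.1; have q1 := (w s(x, y)).2.2
        have r0 := (w s(x, y')).2.1; have r1 := (w s(x, y')).2.2
        constructor <;> nlinarith [mul_nonneg q0 r0, mul_le_one₀ q1 r0 r1]
      obtain ⟨w', hw'def⟩ : ∃ w' : Sym2 (Fin n) → unitInterval, ∀ e, w' e =
          if x ∈ e then 0 else if e = s(y, y') then ⟨_, hval⟩ else w e := ⟨_, fun e => rfl⟩
      have hw'x : ∀ z, w' s(x, z) = 0 := fun z => by rw [hw'def, if_pos (Sym2.mem_mk_left x z)]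
      have hw'e : ∀ e, x ∉ e → e ≠ s(y, y') → w' e = w e := fun e he hne => by rw [hw'def, if_neg he, if_neg hne]
      have hw'yy : (w' s(y, y') : ℝ) = 1 - (1 - w s(y, y')) * (1 - w s(x, y) * w s(x, y')) := by
        have hx : x ∉ s(y, y') := by
          intro h; rcases Sym2.mem_iff.1 h with h | h; exacts [hxy h, hxy' h]
        rw [hw'def, if_neg hx, if_pos rfl]
      have hred := SahiSeriesReduction.sahiE_principal_seriesReduce w w' hxy hxy' hyy' (Ne.symm hxs)
        (fun z hz hz' => hdeg z hz hz') hw'x hw'e hw'yy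
      rw [sahiE3_openConn_eq_of_sahiE_eq w w' (fun T hT => hred 3 T fun i hxT => ?_)]
      swap
      · rcases hT i x hxT with h | h | h; exacts [hxa h, hxb h, hxc h]
      -- under `w'` the vertex `x` is isolated: compute inside `univ.erase x`
      set S : Finset (Fin n) := Finset.univ.erase x with hSdef
      have hSexit : ∀ p ∈ (↑S : Set (Fin n)), ∀ q ∉ (↑S : Set (Fin n)), w' s(p, q) = 0 := by
        intro p _ q hq
        have hqx : q = x := by
          by_contra h; exact hq (Finset.mem_coe.2 (Finset.mem_erase.2 ⟨h, Finset.mem_univ q⟩))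
        rw [hqx, Sym2.eq_swap]; exact hw'x p
      have memS : ∀ {p : Fin n}, p ≠ x → p ∈ S := fun hp => Finset.mem_erase.2 ⟨hp, Finset.mem_univ _⟩
      rw [sahiE3_openConn_eq_openConnIn_of_no_exit w' (↑S) hSexit (Finset.mem_coe.2 (memS (Ne.symm hxs)))]
      have hScard : S.card < n := by
        rw [hSdef, Finset.card_erase_of_mem (Finset.mem_univ x), Finset.card_univ, hcardn]; omega
      exact IH w' S hScard (memS (Ne.symm hxs)) (memS (Ne.symm hxa)) (memS (Ne.symm hxb)) (memS (Ne.symm hxc))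
    -- (3) a blob
    by_cases hI3 : ∀ (B : Finset (Fin n)) (u v : Fin n), B.Nonempty → u ∉ B → v ∉ B → u ≠ v → s ∉ B → a ∉ B → b ∉ B →
        c ∉ B → ∃ x ∈ B, ∃ z, z ∉ B ∧ z ≠ u ∧ z ≠ v ∧ w s(x, z) ≠ 0
    swap
    · push Not at hI3
      obtain ⟨B, u, v, hBne, hu, hv, huv, hsB, haB, hbB, hcB, hblob⟩ := hI3
      obtain ⟨w', hw'B, -, -, hE⟩ := SahiBlobReduction.exists_blobReduce w B hu hv huv
        (fun x hx z hz hzu hzv => hblob x hx z hz hzu hzv)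
      rw [sahiE3_openConn_eq_of_sahiE_eq w w' (fun T hT => hE s hsB 3 T fun i t ht => ?_)]
      swap
      · rcases hT i t ht with rfl | rfl | rfl; exacts [haB, hbB, hcB]
      set S : Finset (Fin n) := Finset.univ \ B with hSdef
      have memS : ∀ {p : Fin n}, p ∉ B → p ∈ S := fun hp => Finset.mem_sdiff.2 ⟨Finset.mem_univ _, hp⟩
      have hSexit : ∀ p ∈ (↑S : Set (Fin n)), ∀ q ∉ (↑S : Set (Fin n)), w' s(p, q) = 0 := by
        intro p _ q hq
        have hqB : q ∈ B := by
          by_contra h; exact hq (Finset.mem_coe.2 (memS h))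
        rw [Sym2.eq_swap]; exact hw'B q hqB p
      rw [sahiE3_openConn_eq_openConnIn_of_no_exit w' (↑S) hSexit (Finset.mem_coe.2 (memS hsB))]
      have hScard : S.card < n := by
        obtain ⟨x₀, hx₀⟩ := hBne
        have : x₀ ∉ S := fun h => (Finset.mem_sdiff.1 h).2 hx₀
        simpa [hcardn] using Finset.card_lt_univ_of_notMem this
      exact IH w' S hScard (memS hsB) (memS haB) (memS hbB) (memS hcB)
    -- (4) a targetless root side
    by_cases hI4 : ∀ (R : Finset (Fin n)) (h u v : Fin n), s ∈ R → h ∈ R → h ≠ s → u ∉ R → v ∉ R → u ≠ v → a ∉ R →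
        b ∉ R → c ∉ R → ∃ x ∈ R, ∃ z, z ∉ R ∧ z ≠ u ∧ z ≠ v ∧ w s(x, z) ≠ 0
    swap
    · push Not at hI4
      obtain ⟨R, h, u, v, hsR, hhR, hhs, huR, hvR, huv, haR, hbR, hcR, hside⟩ := hI4
      refine SahiRootSide.incStar_of_rootSide w R hsR hhR (Ne.symm hhs) huR hvR huv
        (fun x hx z hz hzu hzv => hside x hx z hz hzu hzv) (fun w' _ _ x y z hx hy hz => ?_) haR hbR hcR
      set S : Finset (Fin n) := Finset.univ.erase s with hSdef
      have hS : (↑S : Set (Fin n)) = {t : Fin n | t ≠ s} := by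
        ext t; simp [hSdef]
      have memS : ∀ {p : Fin n}, p ≠ s → p ∈ S := fun hp => Finset.mem_erase.2 ⟨hp, Finset.mem_univ _⟩
      have hScard : S.card < n := by
        rw [hSdef, Finset.card_erase_of_mem (Finset.mem_univ s), Finset.card_univ, hcardn]; omega
      have key := IH w' S hScard (memS hhs) (memS hx) (memS hy) (memS hz)
      rwa [hS] at key
    -- (5) irreducible with independent marks: the hypothesis
    exact H n w s a b c hsa hsb hsc hab hac hbc hloop hI1 hI2 hI3 hI4 (hwle _ zSA) (hwle _ zSB) (hwle _ zSC)
      (hwle _ zAB) (hwle _ zAC) (hwle _ zBC)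
  -- transport to an arbitrary finite vertex type
  have key := incStar_openConnIn_of_fin (V := V) (m := Fintype.card V) (fun w₀ s a b c => finv _ w₀ s a b c) w
    Finset.univ Finset.card_univ (Finset.mem_univ s) (Finset.mem_univ a) (Finset.mem_univ b) (Finset.mem_univ c)
  rw [Finset.coe_univ] at key
  simpa only [openConn_eq_openConnIn_univ] using key

/-- **Structural corollary: at least six vertices, with standard axioms.**  Four pairwise non-adjacent marks on at most five vertices leave
at most one unmarked vertex, which then separates the root from the targets (or, on four vertices, nothing is joined at all); either way the
2-connectedness clause fails.  Hence the hypothesis of `incStar_of_irreducible_indep` may also assume `6 ≤ n` — superseding the computational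
`incStar_of_irreducible_six` (which inherits `native_decide` axioms) by a kernel argument. [this work] -/
theorem incStar_of_irreducible_indep_six
    (H : ∀ (n : ℕ) (w : Sym2 (Fin n) → unitInterval) (s a b c : Fin n), 6 ≤ n →
      s ≠ a → s ≠ b → s ≠ c → a ≠ b → a ≠ c → b ≠ c →
      (∀ x : Fin n, w s(x, x) = 0) →
      (∀ (V₁ V₂ : Finset (Fin n)) (x : Fin n), (∀ y, y ∈ V₁ → y ∈ V₂ → y = x) → x ∈ V₁ → x ∈ V₂ → s ∈ V₁ →
          (∀ y, y ∈ V₁ ∨ y ∈ V₂) → (∀ y z, y ∈ V₁ → z ∈ V₂ → y ≠ x → z ≠ x → w s(y, z) = 0) →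
          (∀ y ∈ V₁, y = x) ∨ (∀ z ∈ V₂, z = x)) →
      (∀ x y y' : Fin n, x ≠ s → x ≠ a → x ≠ b → x ≠ c → x ≠ y → x ≠ y' → y ≠ y' →
          ∃ z, z ≠ y ∧ z ≠ y' ∧ w s(x, z) ≠ 0) →
      (∀ (B : Finset (Fin n)) (u v : Fin n), B.Nonempty → u ∉ B → v ∉ B → u ≠ v → s ∉ B → a ∉ B → b ∉ B → c ∉ B →
          ∃ x ∈ B, ∃ z, z ∉ B ∧ z ≠ u ∧ z ≠ v ∧ w s(x, z) ≠ 0) →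
      (∀ (R : Finset (Fin n)) (h u v : Fin n), s ∈ R → h ∈ R → h ≠ s → u ∉ R → v ∉ R → u ≠ v → a ∉ R → b ∉ R →
          c ∉ R → ∃ x ∈ R, ∃ z, z ∉ R ∧ z ≠ u ∧ z ≠ v ∧ w s(x, z) ≠ 0) →
      w s(s, a) = 0 → w s(s, b) = 0 → w s(s, c) = 0 → w s(a, b) = 0 → w s(a, c) = 0 → w s(b, c) = 0 →
      0 ≤ sahiE3 (prodBernoulli w) (openConn s a) (openConn s b) (openConn s c))
    {V : Type*} [Fintype V] (w : Sym2 V → unitInterval) (s a b c : V) :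
    0 ≤ sahiE3 (prodBernoulli w) (openConn s a) (openConn s b) (openConn s c) := by
  refine incStar_of_irreducible_indep (fun n w s a b c hsa hsb hsc hab hac hbc hloop h2c hdeg hblob hroot
    zSA zSB zSC zAB zAC zBC => ?_) w s a b c
  by_cases hn : 6 ≤ n
  · exact H n w s a b c hn hsa hsb hsc hab hac hbc hloop h2c hdeg hblob hroot zSA zSB zSC zAB zAC zBC
  exfalso
  by_cases hall : ∀ y : Fin n, y = s ∨ y = a ∨ y = b ∨ y = c
  · -- four vertices, no edge at all: `{s,a} ∪ {a,b,c}` is a nontrivial cut decomposition at `a`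
    have key := h2c {s, a} {a, b, c} a
      (fun y hy hy' => by
        simp only [Finset.mem_insert, Finset.mem_singleton] at hy hy'
        rcases hy with rfl | rfl
        · rcases hy' with h | h | h
          · exact h
          · exact absurd h hsb
          · exact absurd h hsc
        · rfl)
      (by simp) (by simp) (by simp)
      (fun y => by
        rcases hall y with rfl | rfl | rfl | rfl <;> simp)
      (fun y z hy hz hya hza => by
        simp only [Finset.mem_insert, Finset.mem_singleton] at hy hz
        rcases hy with rfl | rfl
        · rcases hz with rfl | rfl | rfl
          · exact absurd rfl hza
          · exact zSB
          · exact zSC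
        · exact absurd rfl hya)
    rcases key with h | h
    · exact hsa (h s (by simp))
    · exact hab (h b (by simp)).symm
  push Not at hall
  obtain ⟨z, hzs, hza, hzb, hzc⟩ := hall
  by_cases hall2 : ∀ y : Fin n, y = s ∨ y = a ∨ y = b ∨ y = c ∨ y = z
  · -- five vertices: the unmarked vertex `z` is a cut vertex (`{s,z} ∪ {z,a,b,c}`)
    have key := h2c {s, z} {z, a, b, c} z
      (fun y hy hy' => by
        simp only [Finset.mem_insert, Finset.mem_singleton] at hy hy'
        rcases hy with rfl | rfl
        · rcases hy' with h | h | h | h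
          · exact h
          · exact absurd h hsa
          · exact absurd h hsb
          · exact absurd h hsc
        · rfl)
      (by simp) (by simp) (by simp)
      (fun y => by
        rcases hall2 y with rfl | rfl | rfl | rfl | rfl <;> simp)
      (fun y z' hy hz hyz hzz => by
        simp only [Finset.mem_insert, Finset.mem_singleton] at hy hz
        rcases hy with rfl | rfl
        · rcases hz with rfl | rfl | rfl | rfl
          · exact absurd rfl hzz
          · exact zSA
          · exact zSB
          · exact zSC
        · exact absurd rfl hyz)
    rcases key with h | h
    · exact hzs.symm (h s (by simp))
    · exact hza.symm (h a (by simp))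
  -- six distinct vertices: `n ≥ 6` after all
  push Not at hall2
  obtain ⟨z', hz's, hz'a, hz'b, hz'c, hz'z⟩ := hall2
  have hnd : [s, a, b, c, z, z'].Nodup :=
    List.nodup_cons.2 ⟨by simp [hsa, hsb, hsc, hzs.symm, hz's.symm], List.nodup_cons.2 ⟨by simp [hab, hac, hza.symm, hz'a.symm],
      List.nodup_cons.2 ⟨by simp [hbc, hzb.symm, hz'b.symm], List.nodup_cons.2 ⟨by simp [hzc.symm, hz'c.symm],
        List.nodup_cons.2 ⟨by simp [hz'z.symm], List.nodup_singleton _⟩⟩⟩⟩⟩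
  have hcard := List.toFinset_card_of_nodup hnd
  have hle := Finset.card_le_univ [s, a, b, c, z, z'].toFinset
  rw [hcard, Fintype.card_fin] at hle
  exact hn (by simpa using hle)

end IncStarIrreducible

end Summit.CriticalPhenomena.PercolationContinuityZ3.Theorems
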